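import Summits.BirchSwinnertonDyer.BirchSwinnertonDyer.Theorems.ResidualThetaTransportAtTwoRlfLayerWitnessClass
import Summits.BirchSwinnertonDyer.BirchSwinnertonDyer.Theorems.ResidualThetaTransportAtTwoRlfTwistedLocalKummerWitness
import Summits.BirchSwinnertonDyer.BirchSwinnertonDyer.Theorems.ResidualThetaTransportAtTwoRlfTwistLayerRes
import HarnessLib

/-!
# Route `ResidualThetaTransportAtTwo` (RTT P6, item stmt-BirchSwinnertonDyer-23110, road T), ISO θ-plan, LAYER DICTIONARY bricks
# (D1)–(D4): the class ↔ point dictionary for UNTWISTED layer cocycles of `E[2^J]|` on `U_n` with `A`-witnesses — every layer `n`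

Lead seat `bsd-wall-tp2-p2x` g13 (cell `bsd-wall`), line `hplusdual` on 23110 (stub `stub_iso` ⟸ `TwistedLocalKummer.iso_of_corSurj_of_layerIso`
⟸ COR-SURJ + LAYER-ISO; LAYER-ISO ⟸ θ-plan ⟸ dictionary + extraction). THEOREMS ONLY (no definition, no named fact, no instance, no
`sorry`); closes nothing; 23110 is NOT proved; BSD is NOT proved by any of this.

Setting: `W/ℚ` globally minimal, `GoodSS W 2` (no `2`-torsion up the local tower), `κ` a `ℤ₂`-extension, `v ∋ 2`, `Γ_v = Gal(ℚ̄_v/ℚ_v)`,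
`N = Gal(ℚ̄_v/ℚ_{v,∞}) = localSubgroup (ker κ) ℚ_v`, `U_n = LayerPairing.layerGroup κ v n`, `g ∈ Γ_v` a local lift of the topological
generator, `A = ⋃ₙ E⁺(ℚ_{v,n})`. A WITNESS of a continuous `U_n`-cocycle `f` of `E[2^J]|` (`LayerPairing.torsionLocalRep W (2^J) v`)
is `(Q, k)` with `f(τ) = τQ − Q` on points for `τ ∈ N` and `2^k Q ∈ A` (the binders of `TwistedLocalKummer.iso_of_corSurj_of_layerIso`).
These are the layer-`n` twins of the K1 dictionary T1/T2/T4/T5 of `…RlfTwistedLocalKummerWitness` / `…RlfTwistedLocalKummerCard`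
(there: twisted module, level `Γ_v`, `g`; here: untwisted module, level `U_n`, `g^{2^n}`):

* §1 `pow_mem_layerGroup` (`g^{2^n} ∈ U_n`); (D3) `nsmul_mem_of_layerWitness` (`2^J Q ∈ A`, saturation);
  (D4) `exists_layerEigen_of_layerWitness` (`g^{2^n}(2^J Q) − 2^J Q ∈ 2^J A` — the cocycle identity at `(g^{2^n}, τ)`);
* §2 (D2) `oneCocycleClass_eq_of_layerWitness_sub_mem` (`2^J Q − 2^J Q' ∈ 2^J A ⟹ [f] = [f']`: `res_N` injective on `H¹(U_n, E[2^J]|)`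
  since `E[2^J]^N = 0`, `TwistedLocalCount.geomTorsion_eq_zero_of_forall_local_kerSubgroup_smul_eq`); `add_layerWitness` (witnesses add);
* §3 (D1) `exists_layerCocycle_of_layerFixed_at` — for `b ∈ A` with `g^{2^m} b − b ∈ 2^J A` a `U_m`-cocycle with witness `(Q, J)`,
  `2^J Q = b`, at EVERY layer `m` (w2 g16's `TwistedLocalKummer.exists_layerCocycle_of_layerFixed` is the case `m = J`; the proof is theirs
  verbatim with the layer character `κ_m` — credited).

References: B. D. Kim, Compositio Math. 143 (2007), Prop. 3.15 (proof), Prop. 3.18 [BDKim2007]; R. Greenberg, LNM 1716 (1999), §3 p. 86,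
§4 p. 124 [GreenbergLNM1716]; J.-P. Serre, *Local Fields* (1979), VII §5–§6 [SerreLocalFields1979]; S. Kobayashi, Invent. math. 152
(2003), Def. 1.1, Prop. 8.7 [Kobayashi2003].
-/

-- the Theorems namespace of this sub repeats the summit name by design (D-0017 nested layout)
set_option linter.dupNamespace false

noncomputable section

open scoped Classical NumberField
open CategoryTheory Function Field NumberField IsDedekindDomain

namespace Summit.BirchSwinnertonDyer.BirchSwinnertonDyer.Theorems.SignedEC.LayerWitnessDict

open Literature.NumberTheory.EllipticCurves Literature.NumberTheory.GaloisRepresentations WeierstrassCurve ZpExtension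
  Literature.NumberTheory.EllipticCurves.Kobayashi2003 Literature.NumberTheory.EllipticCurves.Sprung2012 SignedKatoOffTwo
  TwistedLocalKummer
open scoped ContRepresentation

universe u

variable (W : WeierstrassCurve ℚ) [W.IsElliptic] [W.IsGloballyMinimal]

/-! ## §1 `g^{2^n} ∈ U_n`; (D3) the point of a witness lies in `A`; (D4) its layer eigen-relation -/

omit [W.IsElliptic] [W.IsGloballyMinimal] in
/-- `g^{2^n} ∈ U_n` for a local lift `g` of the topological generator (`κ(res g^{2^n}) = 2^n ∈ 2^n ℤ₂`). [cite: Washington1997, §13.1] -/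
theorem pow_mem_layerGroup (κ : ZpExtension ℚ 2) (v : HeightOneSpectrum (𝓞 ℚ)) {g : absoluteGaloisGroup (v.adicCompletion ℚ)}
    (hg : κ.IsTopGenerator (resGalOfEmb (closureEmb (K := ℚ) (v.adicCompletion ℚ)) g)) (n : ℕ) :
    g ^ (2 ^ n) ∈ LayerPairing.layerGroup κ v n := by
  have hg1 : κ (resGal (K := ℚ) (v.adicCompletion ℚ) g) = Multiplicative.ofAdd 1 := by rw [resGal_eq]; exact hg
  refine (mem_localSubgroupOfEmb_iff _ _ _).mpr ?_
  rw [← resGal_eq, ZpExtension.mem_layerSubgroup, map_pow, map_pow, hg1, ← ofAdd_nsmul, toAdd_ofAdd, nsmul_eq_mul, mul_one]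
  exact ⟨1, by push_cast; ring⟩

/-- **(D3) `2^J Q ∈ A` for every witness `(f, Q, k)` of a layer class.** On `N` the values `f(τ) ↦ τQ − Q` are `2^J`-torsion, so
`2^J Q ∈ E(ℚ_{v,∞})`; and `2^k (2^J Q) ∈ A`, so `2^J Q ∈ A` by saturation (`mem_iSup_signedLocalPoints_of_pow_nsmul_mem`).
[cite: Kobayashi2003, Def. 1.1, Prop. 8.7] [cite: BDKim2007, Prop. 3.15 (proof)] -/
theorem nsmul_mem_of_layerWitness (hss : Rank1Residual.GoodSS W 2) (κ : ZpExtension ℚ 2) (J n : ℕ)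
    (v : HeightOneSpectrum (𝓞 ℚ)) (hv : (2 : 𝓞 ℚ) ∈ v.asIdeal)
    (f : contOneCocycles (subgroupRep (LayerPairing.torsionLocalRep W (2 ^ J) v) (LayerPairing.layerGroup κ v n)))
    (Q : localPoints W (v.adicCompletion ℚ)) {k : ℕ}
    (hkQ : 2 ^ k • Q ∈ ⨆ i, signedLocalPoints κ (v.adicCompletion ℚ) W 1 i)
    (hf : ∀ (τ : absoluteGaloisGroup (v.adicCompletion ℚ)) (hτ : τ ∈ localSubgroup κ.kerSubgroup (v.adicCompletion ℚ)),
      pointsMap W (v.adicCompletion ℚ) ((f.1 ⟨τ, TwistLayer.localSubgroup_le_layerGroup κ v n hτ⟩ : W.geomTorsion ((2 ^ J : ℕ) : ℤ)) :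
        W.geomPoints) = τ • Q - Q) :
    2 ^ J • Q ∈ ⨆ i, signedLocalPoints κ (v.adicCompletion ℚ) W 1 i := by
  have galois_smul_nsmul : ∀ (τ : absoluteGaloisGroup (v.adicCompletion ℚ)) (c : ℕ) (P : localPoints W (v.adicCompletion ℚ)),
      τ • (c • P) = c • (τ • P) := fun τ c P ↦ map_nsmul (DistribSMul.toAddMonoidHom _ τ) c P
  have htower : 2 ^ J • Q ∈ localTowerPointsOfEmb κ (closureEmb (K := ℚ) (v.adicCompletion ℚ)) W := by
    rw [mem_localTowerPointsOfEmb_iff]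
    intro τ hτ
    have h := hf τ hτ
    have h2 : 2 ^ J • ((τ • Q) - Q) = 0 := by
      rw [← h, ← map_nsmul, ← AddSubgroupClass.coe_nsmul, W.pow_nsmul_geomTorsion_pow 2 J, ZeroMemClass.coe_zero, map_zero]
    rw [smul_sub, ← galois_smul_nsmul, sub_eq_zero] at h2
    exact h2
  refine mem_iSup_signedLocalPoints_of_pow_nsmul_mem W hss κ v hv htower (k := k) ?_
  rw [smul_comm]
  exact AddSubgroup.nsmul_mem _ hkQ _

/-- **(D4) the layer eigen-relation of the point of a witness**: for a local lift `g` of the topological generator, the point `a = 2^J Q`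
of a witness `(f, Q, k)` of a `U_n`-class satisfies `g^{2^n} a − a ∈ 2^J A`. (The cocycle identity at `(g^{2^n}, τ)` and
`(g^{-2^n} τ g^{2^n}, g^{2^n})` shows that `g^{2^n} Q − Q − ι f(g^{2^n})` is fixed by `N`; multiply by `2^J` and saturate.)
[cite: BDKim2007, Prop. 3.15 (proof)] [cite: GreenbergLNM1716, §4 p. 124] -/
theorem exists_layerEigen_of_layerWitness (hss : Rank1Residual.GoodSS W 2) (κ : ZpExtension ℚ 2) (J n : ℕ)
    (v : HeightOneSpectrum (𝓞 ℚ)) (hv : (2 : 𝓞 ℚ) ∈ v.asIdeal) {g : absoluteGaloisGroup (v.adicCompletion ℚ)}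
    (hg : κ.IsTopGenerator (resGalOfEmb (closureEmb (K := ℚ) (v.adicCompletion ℚ)) g))
    (f : contOneCocycles (subgroupRep (LayerPairing.torsionLocalRep W (2 ^ J) v) (LayerPairing.layerGroup κ v n)))
    (Q : localPoints W (v.adicCompletion ℚ)) {k : ℕ}
    (hkQ : 2 ^ k • Q ∈ ⨆ i, signedLocalPoints κ (v.adicCompletion ℚ) W 1 i)
    (hf : ∀ (τ : absoluteGaloisGroup (v.adicCompletion ℚ)) (hτ : τ ∈ localSubgroup κ.kerSubgroup (v.adicCompletion ℚ)),
      pointsMap W (v.adicCompletion ℚ) ((f.1 ⟨τ, TwistLayer.localSubgroup_le_layerGroup κ v n hτ⟩ : W.geomTorsion ((2 ^ J : ℕ) : ℤ)) :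
        W.geomPoints) = τ • Q - Q) :
    ∃ w ∈ (⨆ i, signedLocalPoints κ (v.adicCompletion ℚ) W 1 i), g ^ (2 ^ n) • (2 ^ J • Q) - 2 ^ J • Q = 2 ^ J • w := by
  haveI : Fact (Nat.Prime 2) := ⟨Nat.prime_two⟩
  let G := absoluteGaloisGroup (v.adicCompletion ℚ)
  let Pt := localPoints W (v.adicCompletion ℚ)
  let N : Subgroup G := localSubgroup κ.kerSubgroup (v.adicCompletion ℚ)
  let U : Subgroup G := LayerPairing.layerGroup κ v n
  haveI hNnormal : N.Normal := by
    change (localSubgroup κ.kerSubgroup (v.adicCompletion ℚ)).Normal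
    rw [localSubgroup_eq_comap]; infer_instance
  have hNU : N ≤ U := TwistLayer.localSubgroup_le_layerGroup κ v n
  set A : AddSubgroup Pt := ⨆ i, signedLocalPoints κ (v.adicCompletion ℚ) W 1 i with hAdef
  let B := W.geomTorsion ((2 ^ J : ℕ) : ℤ)
  let ι : B → Pt := fun b ↦ pointsMap W (v.adicCompletion ℚ) (b : W.geomPoints)
  have galois_smul_nsmul : ∀ (τ : G) (c : ℕ) (P : Pt), τ • (c • P) = c • (τ • P) :=
    fun τ c P ↦ map_nsmul (DistribSMul.toAddMonoidHom Pt τ) c P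
  have hιadd : ∀ a b : B, ι (a + b) = ι a + ι b := fun a b ↦ by
    change pointsMap W _ ((a : W.geomPoints) + b) = _; rw [map_add]
  have hιnsmul : ∀ (c : ℕ) (a : B), ι (c • a) = c • ι a := fun c a ↦ by
    change pointsMap W _ (((c • a : B) : W.geomPoints)) = _
    rw [AddSubgroupClass.coe_nsmul, map_nsmul]
  have hιgal : ∀ (σ : G) (a : B), ι (resGal (K := ℚ) (v.adicCompletion ℚ) σ • a) = σ • ι a := fun σ a ↦ by
    change pointsMap W _ (((resGal (K := ℚ) (v.adicCompletion ℚ) σ • a : B) : W.geomPoints)) = _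
    rw [Literature.NumberTheory.EllipticCurves.AddSubgroup.torsionBy.coe_smul, pointsMap_smul]
  have hιJ : ∀ b : B, 2 ^ J • ι b = 0 := fun b ↦ by
    rw [← hιnsmul, W.pow_nsmul_geomTorsion_pow 2 J b]
    change pointsMap W _ ((0 : B) : W.geomPoints) = 0
    rw [ZeroMemClass.coe_zero, map_zero]
  -- the action on the layer module
  have hX : ∀ (x : U) (m : B), (subgroupRep (LayerPairing.torsionLocalRep W (2 ^ J) v) U).ρ x m =
      resGal (K := ℚ) (v.adicCompletion ℚ) (x : G) • m := fun x m ↦ by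
    rw [subgroupRep_ρ_apply, torsionLocalRep_ρ_apply]
  have hgU : g ^ (2 ^ n) ∈ U := pow_mem_layerGroup κ v hg n
  set γ : G := g ^ (2 ^ n) with hγdef
  let γ' : U := ⟨γ, hgU⟩
  set c : Pt := ι (f.1 γ') with hc
  have hfι : ∀ (τ : G) (hτ : τ ∈ N), ι (f.1 ⟨τ, hNU hτ⟩) = τ • Q - Q := hf
  -- `D := γQ − Q − c` is fixed by `N`
  have hfixD : ∀ τ : G, τ ∈ N → τ • (γ • Q - Q - c) = γ • Q - Q - c := by
    intro τ' hτ'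
    have hτ : γ⁻¹ * τ' * γ ∈ N := by
      have h := Subgroup.Normal.conj_mem hNnormal τ' hτ' γ⁻¹
      rwa [inv_inv] at h
    have e1 : f.1 (γ' * ⟨γ⁻¹ * τ' * γ, hNU hτ⟩) =
        f.1 γ' + (subgroupRep (LayerPairing.torsionLocalRep W (2 ^ J) v) U).ρ γ' (f.1 ⟨γ⁻¹ * τ' * γ, hNU hτ⟩) := f.2 _ _
    have e2 : f.1 (⟨τ', hNU hτ'⟩ * γ') =
        f.1 ⟨τ', hNU hτ'⟩ + (subgroupRep (LayerPairing.torsionLocalRep W (2 ^ J) v) U).ρ ⟨τ', hNU hτ'⟩ (f.1 γ') := f.2 _ _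
    have e3 : γ' * ⟨γ⁻¹ * τ' * γ, hNU hτ⟩ = ⟨τ', hNU hτ'⟩ * γ' := Subtype.ext (by
      change γ * (γ⁻¹ * τ' * γ) = τ' * γ
      group)
    rw [e3, e2, hX, hX] at e1
    have e4 := congrArg ι e1
    rw [hιadd, hιadd, hιgal, hιgal, hfι τ' hτ', hfι _ hτ, smul_sub γ, ← hc] at e4
    have e5 : γ • ((γ⁻¹ * τ' * γ) • Q) = τ' • γ • Q := by
      rw [← mul_smul, ← mul_assoc, ← mul_assoc, mul_inv_cancel, one_mul, mul_smul]
    change τ' • Q - Q + τ' • c = c + (γ • ((γ⁻¹ * τ' * γ) • Q) - γ • Q) at e4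
    rw [e5] at e4
    have e6 : τ' • γ • Q = (τ' • Q - Q + τ' • c) - c + γ • Q := by
      calc τ' • γ • Q = (c + (τ' • γ • Q - γ • Q)) - c + γ • Q := by abel
        _ = (τ' • Q - Q + τ' • c) - c + γ • Q := by rw [← e4]
    rw [smul_sub, smul_sub, e6]
    abel
  have hDtower : γ • Q - Q - c ∈ localTowerPointsOfEmb κ (closureEmb (K := ℚ) (v.adicCompletion ℚ)) W :=
    (mem_localTowerPointsOfEmb_iff κ _ W _).2 hfixD
  -- `a := 2^J Q ∈ A`, `2^J D = γ a − a ∈ A`, so `D ∈ A`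
  have ha : 2 ^ J • Q ∈ A := nsmul_mem_of_layerWitness W hss κ J n v hv f Q hkQ hf
  have hga : γ • (2 ^ J • Q) ∈ A := PlusDualTwo.smul_mem_iSup_signedLocalPoints W κ v γ ha
  have h2D : 2 ^ J • (γ • Q - Q - c) = γ • (2 ^ J • Q) - 2 ^ J • Q := by
    rw [smul_sub, smul_sub, hc, hιJ, sub_zero, galois_smul_nsmul]
  have hDA : γ • Q - Q - c ∈ A := by
    refine mem_iSup_signedLocalPoints_of_pow_nsmul_mem W hss κ v hv hDtower (k := J) ?_
    rw [h2D]
    exact sub_mem hga ha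
  exact ⟨γ • Q - Q - c, hDA, h2D.symm⟩

/-! ## §2 (D2) congruent points give ONE class; witnesses add -/

/-- **(D2) congruent points give ONE layer class** (`res_N : H¹(U_n, E[2^J]|) → H¹(N, E[2^J]|)` is injective — `oneCocycleClass_eq_zero_of_restrict`
with `E[2^J]^N = 0`, `TwistedLocalCount.geomTorsion_eq_zero_of_forall_local_kerSubgroup_smul_eq`): if `(f, Q)`, `(f', Q')` are witnessed
`U_n`-cocycles with `2^J Q − 2^J Q' ∈ 2^J A` then `[f] = [f']`. [cite: BDKim2007, Prop. 3.15 (proof), Prop. 3.18] [cite: GreenbergLNM1716, §3 p. 86] -/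
theorem oneCocycleClass_eq_of_layerWitness_sub_mem (hss : Rank1Residual.GoodSS W 2) (κ : ZpExtension ℚ 2) (J n : ℕ)
    (v : HeightOneSpectrum (𝓞 ℚ)) (hv : (2 : 𝓞 ℚ) ∈ v.asIdeal)
    (f f' : contOneCocycles (subgroupRep (LayerPairing.torsionLocalRep W (2 ^ J) v) (LayerPairing.layerGroup κ v n)))
    (Q Q' : localPoints W (v.adicCompletion ℚ))
    (hf : ∀ (τ : absoluteGaloisGroup (v.adicCompletion ℚ)) (hτ : τ ∈ localSubgroup κ.kerSubgroup (v.adicCompletion ℚ)),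
      pointsMap W (v.adicCompletion ℚ) ((f.1 ⟨τ, TwistLayer.localSubgroup_le_layerGroup κ v n hτ⟩ : W.geomTorsion ((2 ^ J : ℕ) : ℤ)) :
        W.geomPoints) = τ • Q - Q)
    (hf' : ∀ (τ : absoluteGaloisGroup (v.adicCompletion ℚ)) (hτ : τ ∈ localSubgroup κ.kerSubgroup (v.adicCompletion ℚ)),
      pointsMap W (v.adicCompletion ℚ) ((f'.1 ⟨τ, TwistLayer.localSubgroup_le_layerGroup κ v n hτ⟩ : W.geomTorsion ((2 ^ J : ℕ) : ℤ)) :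
        W.geomPoints) = τ • Q' - Q')
    (hQQ' : ∃ w ∈ (⨆ i, signedLocalPoints κ (v.adicCompletion ℚ) W 1 i), 2 ^ J • Q - 2 ^ J • Q' = 2 ^ J • w) :
    oneCocycleClass _ f = oneCocycleClass _ f' := by
  haveI : Fact (Nat.Prime 2) := ⟨Nat.prime_two⟩
  let G := absoluteGaloisGroup (v.adicCompletion ℚ)
  let Pt := localPoints W (v.adicCompletion ℚ)
  let N : Subgroup G := localSubgroup κ.kerSubgroup (v.adicCompletion ℚ)
  let U : Subgroup G := LayerPairing.layerGroup κ v n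
  haveI hNnormal : N.Normal := by
    change (localSubgroup κ.kerSubgroup (v.adicCompletion ℚ)).Normal
    rw [localSubgroup_eq_comap]; infer_instance
  have hNU : N ≤ U := TwistLayer.localSubgroup_le_layerGroup κ v n
  let N' : Subgroup U := N.subgroupOf U
  haveI : N'.Normal := inferInstance
  set A : AddSubgroup Pt := ⨆ i, signedLocalPoints κ (v.adicCompletion ℚ) W 1 i with hAdef
  let nn : ℤ := ((2 ^ J : ℕ) : ℤ)
  have hn : nn ≠ 0 := by
    change ((2 ^ J : ℕ) : ℤ) ≠ 0
    exact_mod_cast pow_ne_zero J two_ne_zero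
  let B := W.geomTorsion nn
  let T : TopRep ℤ U := subgroupRep (LayerPairing.torsionLocalRep W (2 ^ J) v) U
  let ι : B → Pt := fun b ↦ pointsMap W (v.adicCompletion ℚ) (b : W.geomPoints)
  let θ : B ≃+ AddSubgroup.torsionBy Pt nn := W.torsionPointsEquiv nn (E := v.adicCompletion ℚ) hn
  have hιinj : Function.Injective ι := fun a b hab ↦ θ.injective (Subtype.ext hab)
  have hιsub : ∀ a b : B, ι (a - b) = ι a - ι b := fun a b ↦ by
    change pointsMap W _ ((a : W.geomPoints) - b) = _; rw [map_sub]
  have hιgal : ∀ (σ : G) (a : B), ι (resGal (K := ℚ) (v.adicCompletion ℚ) σ • a) = σ • ι a := fun σ a ↦ by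
    change pointsMap W _ (((resGal (K := ℚ) (v.adicCompletion ℚ) σ • a : B) : W.geomPoints)) = _
    rw [Literature.NumberTheory.EllipticCurves.AddSubgroup.torsionBy.coe_smul, pointsMap_smul]
  have hX : ∀ (x : U) (m : B), T.ρ x m = resGal (K := ℚ) (v.adicCompletion ℚ) (x : G) • m := fun x m ↦ by
    change (subgroupRep (LayerPairing.torsionLocalRep W (2 ^ J) v) U).ρ x m = _
    rw [subgroupRep_ρ_apply, torsionLocalRep_ρ_apply]
  have hAtower : A ≤ localTowerPointsOfEmb κ (closureEmb (K := ℚ) (v.adicCompletion ℚ)) W :=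
    PlusDualTwo.iSup_signedLocalPoints_le_localTowerPointsOfEmb W κ v
  -- no `N`-invariants in `E[2^J]`
  have hfixB : ∀ b : B, (∀ τ : N', T.ρ (τ : U) b = b) → b = 0 := by
    intro b hb
    refine TwistedLocalCount.geomTorsion_eq_zero_of_forall_local_kerSubgroup_smul_eq W hss κ J hv b fun τ hτ ↦ ?_
    have h := hb ⟨⟨τ, hNU hτ⟩, Subgroup.mem_subgroupOf.mpr hτ⟩
    rwa [hX] at h
  obtain ⟨w, hw, hwe⟩ := hQQ'
  have hT : Q - Q' - w ∈ AddSubgroup.torsionBy Pt nn := by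
    refine (Submodule.mem_torsionBy_iff _ _).mpr ?_
    change ((2 ^ J : ℕ) : ℤ) • (Q - Q' - w) = 0
    rw [natCast_zsmul, smul_sub, smul_sub, hwe, sub_self]
  let bT : B := θ.symm ⟨Q - Q' - w, hT⟩
  have hιbT : ι bT = Q - Q' - w := W.pointsMap_torsionPointsEquiv_symm nn hn ⟨Q - Q' - w, hT⟩
  have hwN : ∀ τ : G, τ ∈ N → τ • w = w := (mem_localTowerPointsOfEmb_iff κ _ W w).1 (hAtower hw)
  rw [← sub_eq_zero, ← oneCocycleClass_sub]
  refine oneCocycleClass_eq_zero_of_restrict T N' hfixB (f - f') ⟨bT, fun τ ↦ ?_⟩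
  have hτN : ((τ : U) : G) ∈ N := Subgroup.mem_subgroupOf.mp τ.2
  apply hιinj
  change ι (f.1 (τ : U) - f'.1 (τ : U)) = ι (T.ρ (τ : U) bT - bT)
  have ef : ι (f.1 (τ : U)) = ((τ : U) : G) • Q - Q := by
    have h := hf _ hτN; exact h
  have ef' : ι (f'.1 (τ : U)) = ((τ : U) : G) • Q' - Q' := by
    have h := hf' _ hτN; exact h
  rw [hιsub, hιsub, ef, ef', hX, hιgal, hιbT, smul_sub, smul_sub, hwN _ hτN]
  abel

omit [W.IsElliptic] [W.IsGloballyMinimal] in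
/-- **Witnesses add**: if `f`, `f'` have witnesses `Q`, `Q'` on `N` then `f + f'` has the witness `Q + Q'`. [cite: SilvermanAEC2009, VIII §2] -/
theorem add_layerWitness (κ : ZpExtension ℚ 2) (J n : ℕ) (v : HeightOneSpectrum (𝓞 ℚ))
    (f f' : contOneCocycles (subgroupRep (LayerPairing.torsionLocalRep W (2 ^ J) v) (LayerPairing.layerGroup κ v n)))
    (Q Q' : localPoints W (v.adicCompletion ℚ))
    (hf : ∀ (τ : absoluteGaloisGroup (v.adicCompletion ℚ)) (hτ : τ ∈ localSubgroup κ.kerSubgroup (v.adicCompletion ℚ)),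
      pointsMap W (v.adicCompletion ℚ) ((f.1 ⟨τ, TwistLayer.localSubgroup_le_layerGroup κ v n hτ⟩ : W.geomTorsion ((2 ^ J : ℕ) : ℤ)) :
        W.geomPoints) = τ • Q - Q)
    (hf' : ∀ (τ : absoluteGaloisGroup (v.adicCompletion ℚ)) (hτ : τ ∈ localSubgroup κ.kerSubgroup (v.adicCompletion ℚ)),
      pointsMap W (v.adicCompletion ℚ) ((f'.1 ⟨τ, TwistLayer.localSubgroup_le_layerGroup κ v n hτ⟩ : W.geomTorsion ((2 ^ J : ℕ) : ℤ)) :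
        W.geomPoints) = τ • Q' - Q') :
    ∀ (τ : absoluteGaloisGroup (v.adicCompletion ℚ)) (hτ : τ ∈ localSubgroup κ.kerSubgroup (v.adicCompletion ℚ)),
      pointsMap W (v.adicCompletion ℚ) (((f + f').1 ⟨τ, TwistLayer.localSubgroup_le_layerGroup κ v n hτ⟩ : W.geomTorsion ((2 ^ J : ℕ) : ℤ)) :
        W.geomPoints) = τ • (Q + Q') - (Q + Q') := by
  intro τ hτ
  rw [Submodule.coe_add, ContinuousMap.add_apply, AddSubgroup.coe_add, map_add, hf τ hτ, hf' τ hτ, smul_add]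
  abel

end Summit.BirchSwinnertonDyer.BirchSwinnertonDyer.Theorems.SignedEC.LayerWitnessDict

end
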